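import Summits.Ventures.PercRepro.ProfileGapMonoThresholdNullity

/-!
# PercRepro — LINES OF AT MOST 3 POINTS AT CO-RANK 3, I: THE BAD SETS (p5, gen 29; `proofs/P5-GM1.md` §34;
announced INBOX 13565)

On a matroid whose rank-`2` flats have at most `3` elements, the closure excess `ρ(E∖B) − #(E ∖ cl B)` of a rank-`2`
set `B` is at most `1`, and equals `1` exactly for the BAD sets: `#B = 2`, `#(cl B) = 3` and `E ∖ B` independent
(`rk_sdiff_le_card_sdiff_clF_add_ite`).  Hence `thresholdSum N 3 t ≤ Σ_{L_t} #(E ∖ cl B) + #(bad sets of L_t)`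
(`thresholdSum_three_le_add_card_bad`); a demanding bad set forces `t + 3 ≤ #E` (`add_three_le_card_of_bad`,
`filter_bad_eq_empty_of_card_le`).  Two general tools: a subset of an independent finset is independent
(`rk_eq_card_of_subset_indepFin`) and `cl (cl B) ⊆ cl B` (`clF_clF_subset_self`).  The two payment rules are in the
modules `…ThreeLinesFlatUp` / `…ThreeLinesDisjoint`, the theorem in `…ThreeLines`.
-/

open scoped Matroid

namespace PercRepro.Cogirth

open Finset ThmH Skew Shadow Profile

variable {α : Type} [DecidableEq α] {N : Matroid α} [N.Finite]

section Tools

/-- A subset of an independent finset (`ρ = #`) is independent. -/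
theorem rk_eq_card_of_subset_indepFin {X Y : Finset α} (hXY : X ⊆ Y) (hY : rk N Y = Y.card) :
    rk N X = X.card := by
  have h1 : rk N Y ≤ rk N X + rk N (Y \ X) := by
    have := rk_union_le (M := N) X (Y \ X)
    rwa [union_sdiff_of_subset hXY] at this
  have h2 : rk N (Y \ X) ≤ (Y \ X).card := rk_le_card _
  have h3 : (Y \ X).card = Y.card - X.card := card_sdiff_of_subset hXY
  have h4 : X.card ≤ Y.card := card_le_card hXY
  have h5 : rk N X ≤ X.card := rk_le_card _
  omega

/-- `cl (cl B) ⊆ cl B` (idempotence, through ranks). -/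
theorem clF_clF_subset_self (B : Finset α) (hB : B ⊆ gr N) : clF N (clF N B) ⊆ clF N B := by
  intro y hy
  have hyg : y ∈ gr N := clF_subset_gr _ hy
  have h1 := (mem_clF_iff_rk_insert hyg (clF_subset_gr B)).1 hy
  rw [mem_clF_iff_rk_insert hyg hB]
  have h2 : rk N (insert y B) ≤ rk N (insert y (clF N B)) :=
    rk_mono' (insert_subset_insert _ (subset_clF hB))
  have h3 : rk N B ≤ rk N (insert y B) := rk_mono' (subset_insert _ _)
  rw [rk_clF] at h1
  omega

end Tools

section Bad

variable {t : ℕ}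

/-- **The excess of a rank-`2` set on a short line is at most `1`, and `1` only for the bad sets**: with
`#(cl B) ≤ 3`, `ρ(E∖B) ≤ #(E ∖ cl B) + [#B = 2 ∧ #(cl B) = 3 ∧ E ∖ B independent]`. -/
theorem rk_sdiff_le_card_sdiff_clF_add_ite {B : Finset α} (hB : B ∈ Rq N 2) (hline : (clF N B).card ≤ 3) :
    rk N (gr N \ B) ≤ (gr N \ clF N B).card +
      (if B.card = 2 ∧ (clF N B).card = 3 ∧ rk N (gr N \ B) = (gr N \ B).card then 1 else 0) := by
  obtain ⟨hBg, hBr⟩ := mem_Rq.1 hB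
  have hBrk : rk N B = 2 := rk_eq_of_eRk_eq_cq hBr
  have hBc : 2 ≤ B.card := by have := rk_le_card (M := N) B; omega
  have hBcl : B ⊆ clF N B := subset_clF hBg
  have hclg : clF N B ⊆ gr N := clF_subset_gr B
  have h1 : (gr N \ B).card = (gr N \ clF N B).card + (clF N B \ B).card := by
    rw [card_sdiff_of_subset hBg, card_sdiff_of_subset hclg, card_sdiff_of_subset hBcl]
    have := card_le_card hclg
    have := card_le_card hBcl
    omega
  have h2 : (clF N B \ B).card = (clF N B).card - B.card := card_sdiff_of_subset hBcl
  have h3 : (clF N B \ B).card ≤ 1 := by omega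
  have h4 : rk N (gr N \ B) ≤ (gr N \ B).card := rk_le_card _
  split_ifs with h
  · omega
  · rcases Nat.eq_zero_or_pos (clF N B \ B).card with h0 | hpos
    · omega
    · have hc1 : (clF N B \ B).card = 1 := by omega
      have hB2 : B.card = 2 := by omega
      have hcl3 : (clF N B).card = 3 := by omega
      have hne : rk N (gr N \ B) ≠ (gr N \ B).card := fun h' => h ⟨hB2, hcl3, h'⟩
      omega

/-- **`thresholdSum` at co-rank `3` on short lines**: at most the up-pairs plus the number of demanding bad sets. -/
theorem thresholdSum_three_le_add_card_bad (N : Matroid α) [N.Finite] (t : ℕ)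
    (hline : ∀ B ∈ Rq N 2, (clF N B).card ≤ 3) :
    ∑ B ∈ (Rq N 2).filter (fun B => t + 1 ≤ rk N (gr N \ B)), rk N (gr N \ B) ≤
      ∑ B ∈ (Rq N 2).filter (fun B => t + 1 ≤ rk N (gr N \ B)), (gr N \ clF N B).card +
        (((Rq N 2).filter (fun B => t + 1 ≤ rk N (gr N \ B))).filter
          (fun B => B.card = 2 ∧ (clF N B).card = 3 ∧ rk N (gr N \ B) = (gr N \ B).card)).card := by
  rw [card_filter, ← sum_add_distrib]
  apply sum_le_sum
  intro B hB
  exact rk_sdiff_le_card_sdiff_clF_add_ite (mem_filter.1 hB).1 (hline B (mem_filter.1 hB).1)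

/-- A demanding bad set forces `t + 3 ≤ #E` (`ρ(E∖B) = #E − 2 ≥ t + 1`). -/
theorem add_three_le_card_of_bad {B : Finset α} (hB : B ∈ Rq N 2) (ht : t + 1 ≤ rk N (gr N \ B))
    (hbad : B.card = 2 ∧ (clF N B).card = 3 ∧ rk N (gr N \ B) = (gr N \ B).card) :
    t + 3 ≤ (gr N).card := by
  have hBg := (mem_Rq.1 hB).1
  have h1 : (gr N \ B).card = (gr N).card - B.card := card_sdiff_of_subset hBg
  have h2 : B.card ≤ (gr N).card := card_le_card hBg
  omega

/-- **No demanding bad set when `#E ≤ t + 2`.** -/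
theorem filter_bad_eq_empty_of_card_le (h : (gr N).card ≤ t + 2) :
    ((Rq N 2).filter (fun B => t + 1 ≤ rk N (gr N \ B))).filter
      (fun B => B.card = 2 ∧ (clF N B).card = 3 ∧ rk N (gr N \ B) = (gr N \ B).card) = ∅ := by
  rw [filter_eq_empty_iff]
  intro B hB hbad
  have := add_three_le_card_of_bad (mem_filter.1 hB).1 (mem_filter.1 hB).2 hbad
  omega

end Bad

end PercRepro.Cogirth
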